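import Summits.FinalStateConjecture.FinalStateConjecture.Theorems.SwallowTheDatumSubdataDevelopmentsEmbedHmax
import Summits.FinalStateConjecture.FinalStateConjecture.Theorems.SwallowTheDatumSubdataDevelopmentsEmbedMCGHD
import Literature.Geometry.Lorentzian.RelativeDevelopmentGluing
import Literature.Geometry.Lorentzian.DataEmbeddingNormalSmooth

/-!
# Route SwallowTheDatum · item `SubdataDevelopmentsEmbed` (stmt-FinalStateConjecture-10053) —
# the gluing ingredient of `hmax` DISCHARGED: a maximal relative common sub-development of a
# maximal development without corresponding boundary points is everything

`top_of_maximal_relCGHD` (`…SubdataDevelopmentsEmbedHmax.lean`) derives hypothesis (3) of the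
skeleton from (i) `hncb` — a maximal relative common sub-development has no corresponding
boundary points (Sbierski 2016, Thm. 3.5, relative) — and (ii) `hglue` — the gluing `M ∪_ψ M'` as
a vacuum Cauchy development of `D₂` receiving `𝒟` and `𝒟'`. Ingredient (ii) is now a theorem of
the tree: the relative gluing construction `Literature/…/RelativeDevelopmentGluing{Data,Metric,
Cauchy,}.lean` (`VacuumCauchyDevelopment.exists_relative_extension_of_not_hasCorrespondingBoundaryPoints`).
This file feeds it in:

* `hglue_of_relGluing` — from the seven displayed conjuncts of a relative common sub-development
  `(U, ψ)` (with `Φ` injective) and the absence of corresponding boundary points in the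
  `ClusterPt` form, the conclusion of `hglue`: the datum `RelCommonDevelopment` is assembled
  (injectivity of `ψ|_U` by `injOn_of_relCGHD`, the smoothness of the normal by
  `DataEmbedding.mdifferentiableAt_embed_normal`), a corresponding pair of Sbierski's Def. 11 is
  shown to be a cluster point of `ψ` along `U`, and the gluing theorem is applied;
* `top_of_maximal_relCGHD_of_ncb` — **`hmax` from `hncb` alone**: hypothesis (3) of
  `subdataDevelopmentsEmbed_of_skeleton` now rests only on the relative "no corresponding boundary
  points" theorem (Sbierski 2016, Thm. 3.5 = arXiv Thm. 12, relative form).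

Pure composition; no definition, no named fact.
-/

noncomputable section

open Function Set Filter Topology TopologicalSpace Bundle
open scoped Manifold ContDiff Topology

namespace Summit.FinalStateConjecture.FinalStateConjecture.Theorems

namespace SubdataDevelopmentsEmbed

open Literature.Geometry.Lorentzian

universe u

variable {n : ℕ}
  {N : Type u} [TopologicalSpace N] [ChartedSpace (EuclideanSpace ℝ (Fin n)) N]
  [IsManifold (𝓡 n) ∞ N] [ConnectedSpace N] {D₁ : InitialDataSet (𝓡 n) N}
  {X : Type u} [TopologicalSpace X] [ChartedSpace (EuclideanSpace ℝ (Fin n)) X]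
  [IsManifold (𝓡 n) ∞ X] [ConnectedSpace X] {D₂ : InitialDataSet (𝓡 n) X}

/-- **The gluing hypothesis `hglue` of `top_of_maximal_relCGHD`, discharged.** Let `𝒟'` be a
vacuum Cauchy development of `D₁` on `N`, `𝒟` one of `D₂` on `X`, `Φ : N → X` injective, and
`(U, ψ)` a relative common sub-development of `𝒟'` and `𝒟` over `Φ` (the seven displayed
conjuncts) such that no `q ∈ M` is a cluster point of `ψ` along `U` at a point of the frontier
of `U`. Then the gluing `M ∪_ψ M'` is a vacuum Cauchy development `Z` of `D₂` with an embedding of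
developments `jZ : 𝒟 → Z` and a smooth isometric time-orientation preserving open embedding
`j' : M' → Z` over `Φ` with `j' = jZ ∘ ψ` on `U`
(`VacuumCauchyDevelopment.exists_relative_extension_of_not_hasCorrespondingBoundaryPoints`,
Hawking–Ellis 1973, §7.6, p. 250; relative form of Sbierski 2016, §3.3).
[cite: HawkingEllis1973CUP, §7.6, p. 250] -/
theorem hglue_of_relGluing (𝒟' : VacuumCauchyDevelopment.{u} D₁)
    (𝒟 : VacuumCauchyDevelopment.{u} D₂) {Φ : N → X} (hΦ : Injective Φ)
    (U : Opens 𝒟'.carrier) (ψ : 𝒟'.carrier → 𝒟.carrier)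
    (hP : (∀ u, 𝒟'.embed u ∈ U) ∧ IsConnected (U : Set 𝒟'.carrier) ∧
      (𝒟'.metric.restrict PseudoRiemannianMetric.contMDiff_restrict_holds U).IsCauchyHypersurface
        (𝒟'.timeOrientation.restrict PseudoRiemannianMetric.contMDiff_restrict_holds
          𝒟'.timeOrientation.contMDiff_restrict_holds U) (Subtype.val ⁻¹' range 𝒟'.embed) ∧
      ContMDiffOn (𝓡 (n + 1)) (𝓡 (n + 1)) ∞ ψ U ∧
      (∀ p ∈ U, pullbackBilin (I := 𝓡 (n + 1)) (I' := 𝓡 (n + 1)) ψ 𝒟.metric.val p =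
        𝒟'.metric.val p) ∧
      (∀ p ∈ U, 𝒟.timeOrientation.IsFutureDirected
        (mfderiv (𝓡 (n + 1)) (𝓡 (n + 1)) ψ p (𝒟'.timeOrientation.vectorField p))) ∧
      ψ ∘ 𝒟'.embed = 𝒟.embed ∘ Φ)
    (hncb : ∀ p ∈ frontier (U : Set 𝒟'.carrier), ∀ q : 𝒟.carrier,
      ¬ ClusterPt q (map ψ (𝓝[(U : Set 𝒟'.carrier)] p))) :
    ∃ (Z : VacuumCauchyDevelopment.{u} D₂) (jZ : 𝒟.carrier → Z.carrier)
        (j' : 𝒟'.carrier → Z.carrier),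
      (ContMDiff (𝓡 (n + 1)) (𝓡 (n + 1)) ∞ jZ ∧ IsOpenEmbedding jZ ∧
        𝒟.metric.IsIsometricImmersion Z.metric.toPseudoRiemannianMetric jZ ∧
        𝒟.timeOrientation.PreservesTimeOrientation jZ Z.timeOrientation ∧
        jZ ∘ 𝒟.embed = Z.embed) ∧
      (ContMDiff (𝓡 (n + 1)) (𝓡 (n + 1)) ∞ j' ∧ IsOpenEmbedding j' ∧
        𝒟'.metric.IsIsometricImmersion Z.metric.toPseudoRiemannianMetric j' ∧
        𝒟'.timeOrientation.PreservesTimeOrientation j' Z.timeOrientation ∧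
        j' ∘ 𝒟'.embed = Z.embed ∘ Φ) ∧
      ∀ x ∈ U, j' x = jZ (ψ x) := by
  obtain ⟨hι, hU, hC, hs, hi, ht, hc⟩ := hP
  -- `ψ ∘ Subtype.val` is a smooth t.o.p. isometric immersion of `(U, g'|_U)` into `𝒟`
  have hsmooth : ContMDiff (𝓡 (n + 1)) (𝓡 (n + 1)) ∞ (ψ ∘ (Subtype.val : U → 𝒟'.carrier)) :=
    hs.comp_contMDiff contMDiff_subtype_val fun p ↦ p.2
  have hmf : ∀ (y : U) (v : TangentSpace (𝓡 (n + 1)) y),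
      mfderiv (𝓡 (n + 1)) (𝓡 (n + 1)) (ψ ∘ (Subtype.val : U → 𝒟'.carrier)) y v =
        mfderiv (𝓡 (n + 1)) (𝓡 (n + 1)) ψ y.1 v := by
    intro y v
    have hd : MDifferentiableAt (𝓡 (n + 1)) (𝓡 (n + 1)) ψ y.1 :=
      ((hs y.1 y.2).contMDiffAt (U.2.mem_nhds y.2)).mdifferentiableAt (by simp)
    rw [mfderiv_comp y hd
      (hasMFDerivAt_subtypeVal (I' := 𝓡 (n + 1)) (W := U) y).mdifferentiableAt, mfderiv_subtypeVal]
    rfl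
  have hiso : (𝒟'.metric.restrict PseudoRiemannianMetric.contMDiff_restrict_holds U).IsIsometricImmersion
      𝒟.metric.toPseudoRiemannianMetric (ψ ∘ (Subtype.val : U → 𝒟'.carrier)) := by
    refine ⟨hsmooth, fun (y : U) ↦ ?_⟩
    ext v w
    have hk := congrArg (fun b ↦ b v w) (hi y.1 y.2)
    simp only [pullbackBilin_apply] at hk
    change 𝒟.metric.val (ψ y.1)
        (mfderiv (𝓡 (n + 1)) (𝓡 (n + 1)) (ψ ∘ (Subtype.val : U → 𝒟'.carrier)) y v)
        (mfderiv (𝓡 (n + 1)) (𝓡 (n + 1)) (ψ ∘ (Subtype.val : U → 𝒟'.carrier)) y w) =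
      𝒟'.metric.val y.1 v w
    rw [hmf y v, hmf y w]
    exact hk
  have hτ : (𝒟'.timeOrientation.restrict PseudoRiemannianMetric.contMDiff_restrict_holds
      𝒟'.timeOrientation.contMDiff_restrict_holds U).PreservesTimeOrientation
      (ψ ∘ (Subtype.val : U → 𝒟'.carrier)) 𝒟.timeOrientation := fun (y : U) ↦ by
    change 𝒟.timeOrientation.IsFutureDirected
      (mfderiv (𝓡 (n + 1)) (𝓡 (n + 1)) (ψ ∘ (Subtype.val : U → 𝒟'.carrier)) y
        (𝒟'.timeOrientation.vectorField y.1))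
    rw [hmf]
    exact ht y.1 y.2
  have hinjOn : InjOn ψ U :=
    injOn_of_relCGHD 𝒟'.toCauchyDevelopment 𝒟.toCauchyDevelopment hΦ
      (fun x ↦ 𝒟'.toDataEmbedding.mdifferentiableAt_embed_normal x) hι hU hC hs hi ht hc
  -- the relative common development datum
  let 𝔠 : CauchyDevelopment.RelCommonDevelopment 𝒟'.toCauchyDevelopment 𝒟.toCauchyDevelopment Φ :=
    { opens := U
      embed_mem := hι
      isCauchyHypersurface := hC
      map := ψ ∘ (Subtype.val : U → 𝒟'.carrier)
      isIsometricImmersion := hiso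
      preservesTimeOrientation := hτ
      map_comp_embedOpens := funext fun u ↦ congrFun hc u
      injective_map := fun y₁ y₂ h ↦ Subtype.ext (hinjOn y₁.2 y₂.2 h) }
  -- no corresponding boundary points
  have hncb' : ¬ 𝔠.HasCorrespondingBoundaryPoints := by
    rintro ⟨p, q, hpfr, -, hN⟩
    refine hncb p hpfr q ?_
    rw [clusterPt_iff_nonempty]
    intro V' hV' W hW
    rw [mem_map, mem_nhdsWithin] at hW
    obtain ⟨V, hVo, hpV, hVW⟩ := hW
    obtain ⟨y, hyV, hyV'⟩ := hN V (hVo.mem_nhds hpV) V' hV'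
    exact ⟨ψ y, hyV', hVW ⟨hyV, y.2⟩⟩
  obtain ⟨Z, jZ, j', hjZ, hj', hcompat⟩ :=
    VacuumCauchyDevelopment.exists_relative_extension_of_not_hasCorrespondingBoundaryPoints
      𝒟' 𝒟 𝔠 hncb'
  exact ⟨Z, jZ, j', hjZ, hj', fun x hx ↦ hcompat ⟨x, hx⟩⟩

/-- **`hmax` from `hncb` alone.** For a relative common sub-development `(U, ψ)` of a vacuum
Cauchy development `𝒟'` of `D₁` and a MAXIMAL vacuum Cauchy development `𝒟` of `D₂` over an
injective `Φ`, admitting no proper extension: if such a maximal `(U, ψ)` has no corresponding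
boundary points (Sbierski 2016, Thm. 3.5 = arXiv Thm. 12, relative form — the one remaining
displayed ingredient, `hncb`), then `U = M'`: the gluing is `hglue_of_relGluing`, the conclusion
`top_of_noCorrespondingBoundary_of_gluing`. [cite: Sbierski2016AHP, Thm. 3.5 and §3.3] -/
theorem top_of_maximal_relCGHD_of_ncb (𝒟' : VacuumCauchyDevelopment.{u} D₁)
    (𝒟 : VacuumCauchyDevelopment.{u} D₂) (h𝒟 : 𝒟.IsMaximal) {Φ : N → X} (hΦ : Injective Φ)
    (U : Opens 𝒟'.carrier) (ψ : 𝒟'.carrier → 𝒟.carrier)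
    (hP : (∀ u, 𝒟'.embed u ∈ U) ∧ IsConnected (U : Set 𝒟'.carrier) ∧
      (𝒟'.metric.restrict PseudoRiemannianMetric.contMDiff_restrict_holds U).IsCauchyHypersurface
        (𝒟'.timeOrientation.restrict PseudoRiemannianMetric.contMDiff_restrict_holds
          𝒟'.timeOrientation.contMDiff_restrict_holds U) (Subtype.val ⁻¹' range 𝒟'.embed) ∧
      ContMDiffOn (𝓡 (n + 1)) (𝓡 (n + 1)) ∞ ψ U ∧
      (∀ p ∈ U, pullbackBilin (I := 𝓡 (n + 1)) (I' := 𝓡 (n + 1)) ψ 𝒟.metric.val p =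
        𝒟'.metric.val p) ∧
      (∀ p ∈ U, 𝒟.timeOrientation.IsFutureDirected
        (mfderiv (𝓡 (n + 1)) (𝓡 (n + 1)) ψ p (𝒟'.timeOrientation.vectorField p))) ∧
      ψ ∘ 𝒟'.embed = 𝒟.embed ∘ Φ)
    (hUmax : ∀ (U' : Opens 𝒟'.carrier) (ψ' : 𝒟'.carrier → 𝒟.carrier),
      ((∀ u, 𝒟'.embed u ∈ U') ∧ IsConnected (U' : Set 𝒟'.carrier) ∧
      (𝒟'.metric.restrict PseudoRiemannianMetric.contMDiff_restrict_holds U').IsCauchyHypersurface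
        (𝒟'.timeOrientation.restrict PseudoRiemannianMetric.contMDiff_restrict_holds
          𝒟'.timeOrientation.contMDiff_restrict_holds U') (Subtype.val ⁻¹' range 𝒟'.embed) ∧
      ContMDiffOn (𝓡 (n + 1)) (𝓡 (n + 1)) ∞ ψ' U' ∧
      (∀ p ∈ U', pullbackBilin (I := 𝓡 (n + 1)) (I' := 𝓡 (n + 1)) ψ' 𝒟.metric.val p =
        𝒟'.metric.val p) ∧
      (∀ p ∈ U', 𝒟.timeOrientation.IsFutureDirected
        (mfderiv (𝓡 (n + 1)) (𝓡 (n + 1)) ψ' p (𝒟'.timeOrientation.vectorField p))) ∧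
      ψ' ∘ 𝒟'.embed = 𝒟.embed ∘ Φ) →
      U ≤ U' → EqOn ψ ψ' U → U' = U)
    (hncb : ∀ p ∈ frontier (U : Set 𝒟'.carrier), ∀ q : 𝒟.carrier,
      ¬ ClusterPt q (map ψ (𝓝[(U : Set 𝒟'.carrier)] p))) :
    U = ⊤ :=
  top_of_noCorrespondingBoundary_of_gluing 𝒟'.toCauchyDevelopment 𝒟 h𝒟 Φ U ψ hUmax
    (hglue_of_relGluing 𝒟' 𝒟 hΦ U ψ hP hncb)

end SubdataDevelopmentsEmbed

end Summit.FinalStateConjecture.FinalStateConjecture.Theorems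

end
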